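import Mathlib.Algebra.Polynomial.Degree.SmallDegree
import Mathlib.AlgebraicGeometry.EllipticCurve.Affine.Point
import Literature.NumberTheory.DiophantineGeometry.LocalReductionProofs
import Literature.NumberTheory.DiophantineGeometry.LocalReductionHasMultiplicativeReductionAtProofs
import Literature.NumberTheory.DiophantineGeometry.LocalReductionIsIntegralAtProofs
import Literature.NumberTheory.DiophantineGeometry.LocalReductionIsSemistableAtProofs
import Literature.RingTheory.DiscreteValuationRing.AdicCompletionResidueField
import Summits.ABC.IUTFork.Repair.RcatZhou2TorsionNonsplitWitness
import HarnessLib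

/-!
# D-0123(C) IUT REPAIR-CATALOGUE (rung LADDER-ABC:A2), row RC-441 (Zhou 2025 «2-torsion initial Θ-data»,
# [IUTchI] Def. 3.1 (b) datum-class variant) — a SEMISTABLE classical witness for the print-silent check-list
# item «rational 2-torsion (with `√−1` in the completion) does NOT force SPLIT multiplicative reduction»

Record file (D-0012) of the abc-iut cell, seat abc-iut-rcat-tst-7 (KEY RC441), gen 3; PROOF-ONLY (no definition,
no instance, no notation, no named fact). TAKES NO SIDE on [IUTchIII] Cor. 3.12 / [IUTchIV] Thm. 1.10, on any author
or on the variant (D-0045); nothing here asserts abc proved or refuted. The variant is a claim-tagged READING of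
the literature; this file is classical arithmetic of ONE explicit curve over `ℚ`.

CONTEXT (catalogue sheet HOME/staging/RCAT/tst-7/RC-441.md, C column). The companion file
`RcatZhou2TorsionNonsplitWitness` (p524971) records the LOCAL point on `y² = x(x − 2)(x − 25)`: full rational
`2`-torsion, `−1` a square mod `5`, multiplicative but NOT split reduction at `5`. That curve is additive at `2`
(conductor `2⁵·5·23`, rcat-tst-8 g4, PARI kit j276225), so it does not satisfy the clause of [IUTchI] Def. 3.1 (b)
KEPT by the variant, «`E_F` has stable reduction at every nonarchimedean `v`». rcat-tst-8 g4 proposed the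
semistable replacement `E₂ : y² = x(x − 3)(x + 160)` and checked it in PARI (computed ≠ proved). THIS FILE proves
it in the kernel: `E₂ : y² = x³ + 157x² − 480x` over `ℚ`
* has its three points of order `2` rational (`x = 0, 3, −160`);
* is SEMISTABLE AT EVERY finite place of `ℚ` (`WeierstrassCurve.IsSemistable ℤ`): the `ℚ`-isomorphic integral
  model `W₀ : y² + xy = x³ + 39x² − 30x` (change of variables `u = 2, r = 0, s = 1, t = 0`) has
  `c₄ = 26089 = 7·3727` and `Δ = 23912100 = (2·3·5·163)²` COPRIME in `ℤ`
  (`(−7150991)·26089 + 7802·23912100 = 1`), so the tree's global criterion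
  `WeierstrassCurve.isSemistable_baseChange_of_isCoprime` (Silverman AEC VII.5 Prop. 5.1 (a),(b) with VII.1
  Rmk. 1.1) applies, and semistability is an isomorphism invariant (`isSemistable_smul_iff_holds`);
* has MULTIPLICATIVE reduction at `5` (`5 ∤ c₄(E₂) = 417424`, `5 ∣ Δ(E₂) = 2¹⁴·3²·5²·163²`) which is NOT SPLIT:
  the node-tangent quadratic `c₄T² + a₁c₄T − (54b₆ − 3b₂b₄ + a₂c₄) = 417424·T² − 67344208` of the (`5`-minimal,
  integral) equation has no root in `κ(O_v) = 𝔽₅` (`4T² + 2 ≡ 0` forces `T² ≡ 3`, a non-square; reduction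
  `y² ≡ x²(x + 2) (mod 5)`, node `(0,0)`, tangent slopes² `≡ 2`).
Since `2² ≡ −1 (mod 5)`, `√−1 ∈ ℚ₅` (Hensel) and the completion of `F = ℚ(√−1)` at a place above `5` is `ℚ₅`;
semistability is preserved under base change. So over `F = ℚ(√−1)` the curve `E₂` (with `j ∈ ℚ = F_mod`, its own
model over `F_mod`) meets the variant's clauses «`√−1 ∈ F`», «stable reduction at all finite places», «`2`-torsion
rational», «model over `F_mod`», while abc-iut-L5-t12's print-silent conclusion for [IUTchI] Def. 3.1 (b)
(`InitialThetaDataSplitBaseProofs.hasSplitMultiplicativeReductionAt_base_of_mem_VFbad`: SPLIT multiplicative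
reduction of the BASE curve at the bad places, obtained there from the rational `3`-torsion) FAILS at the places
above `5` — the base-change / `ℚ(√−1)` sentences are prose, NOT kernel statements of this file; clauses (c)–(f) of
Def. 3.1 are not examined (this is a witness for ONE located check-list item, not a `2`-torsion initial Θ-datum).
Whether the variant ever needs base-curve split-ness is for its author, not this cell (located/computed/proved
classical facts ≠ adjudication). Pattern of proof: p524971 and the tree's `Curve5077aRootNumber`. Standard axioms only.
-/

open IsDedekindDomain IsDedekindDomain.HeightOneSpectrum WeierstrassCurve Polynomial

namespace Summit.ABC.IUTFork.Repair.RcatZhou2TorsionSemistableWitness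

/-! ## 1. The curve `E₂ : y² = x³ + 157x² − 480x = x(x − 3)(x + 160)` over `ℚ`: invariants -/

/-- The cubic factors as printed: `x³ + 157x² − 480x = x(x − 3)(x + 160)` (Frey shape `x(x − A)(x + B)` with
`A = 3`, `B = 160 = 2⁵·5`, `A + B = 163`). [folklore] -/
theorem E_cubic_factor (x : ℚ) : x ^ 3 + 157 * x ^ 2 - 480 * x = x * (x - 3) * (x + 160) := by ring

/-- `b₂ = 628`. [folklore] -/
theorem E_b₂ : (⟨0, 157, 0, -480, 0⟩ : WeierstrassCurve ℚ).b₂ = 628 := by norm_num [WeierstrassCurve.b₂]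

/-- `b₄ = −960`. [folklore] -/
theorem E_b₄ : (⟨0, 157, 0, -480, 0⟩ : WeierstrassCurve ℚ).b₄ = -960 := by norm_num [WeierstrassCurve.b₄]

/-- `b₆ = 0`. [folklore] -/
theorem E_b₆ : (⟨0, 157, 0, -480, 0⟩ : WeierstrassCurve ℚ).b₆ = 0 := by norm_num [WeierstrassCurve.b₆]

/-- `c₄ = 417424 = 2⁴·7·3727` (prime to `3·5·163`). [folklore] -/
theorem E_c₄ : (⟨0, 157, 0, -480, 0⟩ : WeierstrassCurve ℚ).c₄ = 417424 := by
  norm_num [WeierstrassCurve.c₄, WeierstrassCurve.b₂, WeierstrassCurve.b₄]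

/-- `Δ = 97943961600 = 16·(3·160·163)² = 2¹⁴·3²·5²·163²`. [folklore] -/
theorem E_Δ : (⟨0, 157, 0, -480, 0⟩ : WeierstrassCurve ℚ).Δ = 97943961600 := by
  norm_num [WeierstrassCurve.Δ, WeierstrassCurve.b₂, WeierstrassCurve.b₄, WeierstrassCurve.b₆,
    WeierstrassCurve.b₈]

/-- The discriminant in factored form: `Δ = 2¹⁴·3²·5²·163²`. [folklore] -/
theorem E_Δ_factored : (⟨0, 157, 0, -480, 0⟩ : WeierstrassCurve ℚ).Δ = 2 ^ 14 * 3 ^ 2 * 5 ^ 2 * 163 ^ 2 := by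
  rw [E_Δ]; norm_num

/-- `E₂` is an elliptic curve (`Δ ≠ 0`). [folklore] -/
theorem E_isElliptic : (⟨0, 157, 0, -480, 0⟩ : WeierstrassCurve ℚ).IsElliptic := by
  rw [WeierstrassCurve.isElliptic_iff, E_Δ]; norm_num

/-! ## 2. Full rational `2`-torsion: the three points `(0,0)`, `(3,0)`, `(−160,0)` of order `2` -/

/-- `(0, 0)`, `(3, 0)` and `(−160, 0)` are nonsingular `ℚ`-points of `E₂`. [folklore] -/
theorem E_nonsingular_two_torsion :
    (⟨0, 157, 0, -480, 0⟩ : WeierstrassCurve ℚ).toAffine.Nonsingular 0 0 ∧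
      (⟨0, 157, 0, -480, 0⟩ : WeierstrassCurve ℚ).toAffine.Nonsingular 3 0 ∧
      (⟨0, 157, 0, -480, 0⟩ : WeierstrassCurve ℚ).toAffine.Nonsingular (-160) 0 := by
  refine ⟨?_, ?_, ?_⟩ <;>
  · rw [WeierstrassCurve.Affine.nonsingular_iff, WeierstrassCurve.Affine.equation_iff]
    norm_num

/-- **Full rational `2`-torsion**: every rational point `(r, 0)` of `E₂` — in particular the three points
`r ∈ {0, 3, −160}` of `E_nonsingular_two_torsion` — has order `2` (`P + P = O`). With `O` these are all four
`2`-torsion points of `E₂` over `ℚ̄` (`#E[2] = 4`), so «the 2-torsion points are rational over `ℚ`» in the sense of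
the variant's clause. [folklore] -/
theorem E_two_torsion_rational (r : ℚ)
    (h : (⟨0, 157, 0, -480, 0⟩ : WeierstrassCurve ℚ).toAffine.Nonsingular r 0) :
    (WeierstrassCurve.Affine.Point.some r 0 h : (⟨0, 157, 0, -480, 0⟩ : WeierstrassCurve ℚ).toAffine.Point) +
      WeierstrassCurve.Affine.Point.some r 0 h = 0 := by
  have hy : (0 : ℚ) = (⟨0, 157, 0, -480, 0⟩ : WeierstrassCurve ℚ).toAffine.negY r 0 := by
    simp [WeierstrassCurve.Affine.negY]
  rw [WeierstrassCurve.Affine.Point.add_of_Y_eq rfl hy]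

/-! ## 3. Semistable at EVERY finite place of `ℚ`, via the global minimal model `W₀ : y² + xy = x³ + 39x² − 30x` -/

/-- `c₄(W₀) = 26089 = 7·3727`. [folklore] -/
theorem W₀_c₄ : (⟨1, 39, 0, -30, 0⟩ : WeierstrassCurve ℤ).c₄ = 26089 := by
  norm_num [WeierstrassCurve.c₄, WeierstrassCurve.b₂, WeierstrassCurve.b₄]

/-- `Δ(W₀) = 23912100 = (2·3·5·163)² = 4890²`. [folklore] -/
theorem W₀_Δ : (⟨1, 39, 0, -30, 0⟩ : WeierstrassCurve ℤ).Δ = 23912100 := by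
  norm_num [WeierstrassCurve.Δ, WeierstrassCurve.b₂, WeierstrassCurve.b₄, WeierstrassCurve.b₆,
    WeierstrassCurve.b₈]

/-- `Δ(W₀) = (2·3·5·163)²`: the bad primes of `W₀` are exactly `2, 3, 5, 163`, each with `ord_p Δ = 2`
(type `I₂`). [folklore] -/
theorem W₀_Δ_factored : (⟨1, 39, 0, -30, 0⟩ : WeierstrassCurve ℤ).Δ = (2 * 3 * 5 * 163) ^ 2 := by
  rw [W₀_Δ]; norm_num

/-- `c₄(W₀)` and `Δ(W₀)` are coprime in `ℤ`: `(−7150991)·26089 + 7802·23912100 = 1`. [folklore] -/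
theorem W₀_isCoprime_c₄_Δ :
    IsCoprime (⟨1, 39, 0, -30, 0⟩ : WeierstrassCurve ℤ).c₄ (⟨1, 39, 0, -30, 0⟩ : WeierstrassCurve ℤ).Δ := by
  rw [W₀_c₄, W₀_Δ]
  exact ⟨-7150991, 7802, by norm_num⟩

/-- The change of variables `u = 2, r = 0, s = 1, t = 0` (`x = 4x'`, `y = 8y' + 4x'`) carries `E₂` to the integral
model `W₀`: `(2, 0, 1, 0) • E₂ = W₀ ⊗ ℚ`. [folklore] -/
theorem smul_E_eq_W₀ :
    (⟨Units.mk0 (2 : ℚ) two_ne_zero, 0, 1, 0⟩ : VariableChange ℚ) • (⟨0, 157, 0, -480, 0⟩ : WeierstrassCurve ℚ)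
      = (⟨1, 39, 0, -30, 0⟩ : WeierstrassCurve ℤ).baseChange ℚ := by
  ext <;> simp [WeierstrassCurve.baseChange, WeierstrassCurve.map, variableChange_a₁, variableChange_a₂,
    variableChange_a₃, variableChange_a₄, variableChange_a₆] <;> norm_num

/-- **`E₂` is semistable** (good or multiplicative reduction at EVERY finite place of `ℚ`): the isomorphic integral
model `W₀` has coprime `c₄`, `Δ` (`isSemistable_baseChange_of_isCoprime`, Silverman AEC VII.5 Prop. 5.1 (a),(b)
with VII.1 Rmk. 1.1), and semistability is invariant under a change of variables over `ℚ`
(`isSemistable_smul_iff_holds`). [cite: SilvermanAEC2009, VII.5 Prop. 5.1(a),(b)] -/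
theorem E_isSemistable : (⟨0, 157, 0, -480, 0⟩ : WeierstrassCurve ℚ).IsSemistable ℤ := by
  haveI := E_isElliptic
  have hΔ : (⟨1, 39, 0, -30, 0⟩ : WeierstrassCurve ℤ).Δ ≠ 0 := by rw [W₀_Δ]; norm_num
  have h := isSemistable_baseChange_of_isCoprime (K := ℚ) _ hΔ W₀_isCoprime_c₄_Δ
  rw [← smul_E_eq_W₀] at h
  exact (isSemistable_smul_iff_holds ℤ (⟨0, 157, 0, -480, 0⟩ : WeierstrassCurve ℚ) _).mp h

/-- In particular `E₂` is semistable at every single finite place `v` of `ℚ` (no additive reduction anywhere —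
contrast the companion witness `y² = x(x − 2)(x − 25)`, additive at `2`). [folklore] -/
theorem E_isSemistableAt (v : HeightOneSpectrum ℤ) : (⟨0, 157, 0, -480, 0⟩ : WeierstrassCurve ℚ).IsSemistableAt v :=
  E_isSemistable v

/-! ## 4. At `p = 5`: multiplicative, NOT split -/

/-- The equation of `E₂` has integer coefficients: integral at every finite place of `ℤ`. [folklore] -/
theorem E_isIntegralAt (v : HeightOneSpectrum ℤ) : (⟨0, 157, 0, -480, 0⟩ : WeierstrassCurve ℚ).IsIntegralAt v := by
  rw [isIntegralAt_iff_valuation_le_one]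
  refine ⟨?_, ?_, ?_, ?_, ?_⟩
  · simp
  · have h := v.valuation_le_one (K := ℚ) (157 : ℤ)
    change v.valuation ℚ ((algebraMap ℤ ℚ) (157 : ℤ)) ≤ 1 at h
    have e : (algebraMap ℤ ℚ) (157 : ℤ) = (157 : ℚ) := by rw [map_ofNat]
    rw [e] at h
    simpa using h
  · simp
  · have h := v.valuation_le_one (K := ℚ) (-480 : ℤ)
    change v.valuation ℚ ((algebraMap ℤ ℚ) (-480 : ℤ)) ≤ 1 at h
    have e : (algebraMap ℤ ℚ) (-480 : ℤ) = (-480 : ℚ) := by rw [map_neg, map_ofNat]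
    rw [e] at h
    simpa using h
  · simp

/-- `417424 ∉ v` when `5 ∈ v` (Bezout: `4·417424 − 333939·5 = 1`). [folklore] -/
private theorem not_mem_417424 {v : HeightOneSpectrum ℤ} (h5 : (5 : ℤ) ∈ v.asIdeal) :
    (417424 : ℤ) ∉ v.asIdeal := by
  intro hc
  have hone : (1 : ℤ) ∈ v.asIdeal := by
    have := v.asIdeal.add_mem (v.asIdeal.mul_mem_left (-333939) h5) (v.asIdeal.mul_mem_left 4 hc)
    convert this using 1
    norm_num
  exact v.isPrime.ne_top ((Ideal.eq_top_iff_one _).mpr hone)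

/-- At the place above `5`, `c₄ = 417424` is a `v`-unit. [folklore] -/
theorem valuation_c₄_eq_one {v : HeightOneSpectrum ℤ} (h5 : (5 : ℤ) ∈ v.asIdeal) :
    v.valuation ℚ (⟨0, 157, 0, -480, 0⟩ : WeierstrassCurve ℚ).c₄ = 1 := by
  rw [E_c₄]
  by_contra h
  have h' : v.valuation ℚ (algebraMap ℤ ℚ 417424) ≠ 1 := by simpa using h
  have hlt := lt_of_le_of_ne (v.valuation_le_one (417424 : ℤ)) h'
  exact not_mem_417424 h5 ((v.valuation_lt_one_iff_mem (417424 : ℤ)).mp hlt)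

/-- At the place above `5`, `v(Δ) < 1` (`Δ = 5 · 19588792320`). [folklore] -/
theorem valuation_Δ_lt_one {v : HeightOneSpectrum ℤ} (h5 : (5 : ℤ) ∈ v.asIdeal) :
    v.valuation ℚ (⟨0, 157, 0, -480, 0⟩ : WeierstrassCurve ℚ).Δ < 1 := by
  rw [E_Δ]
  have e : (97943961600 : ℚ) = algebraMap ℤ ℚ 5 * algebraMap ℤ ℚ 19588792320 := by
    rw [map_ofNat, map_ofNat]; norm_num
  rw [e, map_mul]
  calc v.valuation ℚ (algebraMap ℤ ℚ 5) * v.valuation ℚ (algebraMap ℤ ℚ 19588792320)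
      ≤ v.valuation ℚ (algebraMap ℤ ℚ 5) * 1 :=
        mul_le_mul_right (v.valuation_le_one (19588792320 : ℤ)) _
    _ < 1 := by rw [mul_one]; exact (v.valuation_lt_one_iff_mem (5 : ℤ)).mpr h5

/-- **Multiplicative reduction of `E₂` at `5`** (`v(c₄) = 1`, `v(Δ) < 1`; Silverman AEC VII.5 Prop. 5.1 (b)) — so
`5` is a place of BAD (multiplicative) reduction of the semistable curve `E₂`.
[cite: SilvermanAEC2009, VII.5 Prop. 5.1(b)] -/
theorem hasMultiplicativeReductionAt_five {v : HeightOneSpectrum ℤ} (h5 : (5 : ℤ) ∈ v.asIdeal) :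
    (⟨0, 157, 0, -480, 0⟩ : WeierstrassCurve ℚ).HasMultiplicativeReductionAt v :=
  haveI := E_isElliptic
  hasMultiplicativeReductionAt_of_valuation_c₄_eq_one (E_isIntegralAt v) (valuation_c₄_eq_one h5)
    (valuation_Δ_lt_one h5)

/-- The arithmetic heart: `4T² + 2` has no root in `𝔽₅` (`T² = 3` is not a square mod `5`), written for the integer
lift `417424 r² − 67344208 ∈ v ∋ 5`. [folklore] -/
private theorem no_int_root {v : HeightOneSpectrum ℤ} (h5 : (5 : ℤ) ∈ v.asIdeal) (r : ℤ)
    (hr : 417424 * r ^ 2 - 67344208 ∈ v.asIdeal) : False := by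
  have hdvd : (5 : ℤ) ∣ 417424 * r ^ 2 - 67344208 := by
    by_contra hnd
    have hp : Prime (5 : ℤ) := Int.prime_iff_natAbs_prime.mpr Nat.prime_five
    obtain ⟨a, b, hab⟩ := (hp.coprime_iff_not_dvd).mpr hnd
    have hone : (1 : ℤ) ∈ v.asIdeal := by
      rw [← hab]
      exact v.asIdeal.add_mem (v.asIdeal.mul_mem_left a h5) (v.asIdeal.mul_mem_left b hr)
    exact v.isPrime.ne_top ((Ideal.eq_top_iff_one _).mpr hone)
  have hz : ((417424 * r ^ 2 - 67344208 : ℤ) : ZMod 5) = 0 :=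
    (ZMod.intCast_zmod_eq_zero_iff_dvd _ 5).mpr (by exact_mod_cast hdvd)
  push_cast at hz
  have key : ∀ z : ZMod 5, (417424 : ZMod 5) * z ^ 2 - 67344208 ≠ 0 := by decide
  exact key _ hz

/-- **NON-split multiplicative reduction of `E₂` at `5`**: for the place `v` above `5`, the chosen local minimal
model does NOT have split multiplicative reduction — the node-tangent quadratic `417424·T² − 67344208` of the
(minimal, integral) equation has no root in `κ(O_v) = 𝔽₅`; the tangent slopes at the node `(0,0)` of
`y² ≡ x²(x + 2)` satisfy `T² ≡ 2·4⁻¹ ≡ 3 (mod 5)`. [cite: SilvermanAEC2009, VII.5 Prop. 5.1(b)] -/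
theorem not_hasSplitMultiplicativeReductionAt_five {v : HeightOneSpectrum ℤ} (h5 : (5 : ℤ) ∈ v.asIdeal) :
    ¬ (⟨0, 157, 0, -480, 0⟩ : WeierstrassCurve ℚ).HasSplitMultiplicativeReductionAt v := by
  set E : WeierstrassCurve ℚ := ⟨0, 157, 0, -480, 0⟩ with hE
  haveI : E.IsElliptic := E_isElliptic
  have hc₄ := valuation_c₄_eq_one h5
  have hW := E_isIntegralAt v
  set O := v.adicCompletionIntegers ℚ with hO
  set K := v.adicCompletion ℚ with hK
  set EK := E.baseChange K with hEK
  haveI hmin : EK.IsMinimal O :=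
    isMinimalAt_of_lt_valuation_c₄ hW
      (by rw [hc₄, ← WithZero.exp_zero]; exact WithZero.exp_lt_exp.mpr (by norm_num))
  haveI : EK.IsElliptic := by rw [hEK, WeierstrassCurve.baseChange]; infer_instance
  obtain ⟨D, hD⟩ : ∃ D : VariableChange K, E.localMinimalModel v = D • EK := ⟨_, rfl⟩
  unfold WeierstrassCurve.HasSplitMultiplicativeReductionAt
  rw [hasSplitMultiplicativeReduction_iff_of_isMinimal_of_eq_smul O hD EK.isUnit_Δ.ne_zero,
    hasSplitMultiplicativeReduction_iff]
  intro hS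
  obtain ⟨hm, hsplit⟩ := hS
  -- the integral model of `EK = E₂ ⊗ K_v` has the integer coefficients of `E₂`
  have inj := IsFractionRing.injective O K
  have hnat : ∀ n : ℕ, algebraMap O K (n : O) = (n : K) := fun n => map_natCast _ n
  have hc4 : (EK.integralModel O).c₄ = ((417424 : ℕ) : O) := inj <| by
    rw [integralModel_c₄_eq, hnat, hEK, WeierstrassCurve.baseChange, map_c₄, E_c₄]; norm_num
  have ha1 : (EK.integralModel O).a₁ = 0 := inj <| by
    rw [integralModel_a₁_eq, hEK, WeierstrassCurve.baseChange, map_a₁]; simp [hE]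
  have ha2 : (EK.integralModel O).a₂ = ((157 : ℕ) : O) := inj <| by
    rw [integralModel_a₂_eq, hnat, hEK, WeierstrassCurve.baseChange, map_a₂]; simp [hE]
  have hb2 : (EK.integralModel O).b₂ = ((628 : ℕ) : O) := inj <| by
    rw [integralModel_b₂_eq, hnat, hEK, WeierstrassCurve.baseChange, map_b₂, E_b₂]; norm_num
  have hb4 : (EK.integralModel O).b₄ = -((960 : ℕ) : O) := inj <| by
    rw [integralModel_b₄_eq, map_neg, hnat, hEK, WeierstrassCurve.baseChange, map_b₄, E_b₄]; norm_num
  have hb6 : (EK.integralModel O).b₆ = 0 := inj <| by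
    rw [integralModel_b₆_eq, hEK, WeierstrassCurve.baseChange, map_b₆, E_b₆]; simp
  rw [hc4, ha1, ha2, hb2, hb4, hb6] at hsplit
  push_cast at hsplit
  -- the node-tangent quadratic over `κ(O_v)` is `417424 T² − 67344208`
  set φ : O →+* IsLocalRing.ResidueField O := algebraMap O (IsLocalRing.ResidueField O) with hφ
  have h417424 : (417424 : IsLocalRing.ResidueField O) ≠ 0 := by
    intro h0
    have : ((IsLocalRing.residue O).comp (algebraMap ℤ O)) 417424 = 0 := by
      rw [RingHom.comp_apply, map_ofNat, map_ofNat]; exact h0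
    have hmem : (417424 : ℤ) ∈ v.asIdeal := by
      rw [← ker_residue_comp_algebraMap ℚ v]; exact this
    exact not_mem_417424 h5 hmem
  have hpoly : Polynomial.map φ (C (417424 : O) * X ^ 2 + C (0 * 417424) * X
      - C (54 * 0 - 3 * 628 * -960 + 157 * 417424)) = C (417424 : IsLocalRing.ResidueField O) * X ^ 2
      + C (0 : IsLocalRing.ResidueField O) * X + C (-67344208 : IsLocalRing.ResidueField O) := by
    simp only [Polynomial.map_sub, Polynomial.map_add, Polynomial.map_mul, Polynomial.map_pow,
      Polynomial.map_X, map_mul, map_sub, map_add, map_neg, map_ofNat, map_zero]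
    norm_num [sub_eq_add_neg, ← C_neg]
  rw [hpoly] at hsplit
  have hdeg : (C (417424 : IsLocalRing.ResidueField O) * X ^ 2 + C (0 : IsLocalRing.ResidueField O) * X
      + C (-67344208 : IsLocalRing.ResidueField O)).degree ≠ 0 := by
    rw [degree_quadratic h417424]; decide
  obtain ⟨t, ht⟩ := hsplit.exists_eval_eq_zero hdeg
  simp only [eval_add, eval_mul, eval_C, eval_pow, eval_X, zero_mul, add_zero] at ht
  -- lift the root to an integer
  obtain ⟨r, hr⟩ := residue_comp_algebraMap_surjective ℚ v t
  have hι : ((IsLocalRing.residue O).comp (algebraMap ℤ O)) (417424 * r ^ 2 - 67344208) = 0 := by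
    rw [map_sub, map_mul, map_pow, hr, map_ofNat, map_ofNat]
    linear_combination ht
  have hmem : (417424 * r ^ 2 - 67344208 : ℤ) ∈ v.asIdeal := by
    rw [← ker_residue_comp_algebraMap ℚ v]; exact hι
  exact no_int_root h5 r hmem

/-! ## 5. Summary -/

/-- **Summary (the located check-list item, kernel form).** `E₂ : y² = x(x − 3)(x + 160)` over `ℚ` is semistable at
every finite place, has its `2`-torsion rational, and at the bad place `5` — where `−1` is a square, so the local
field is that of `ℚ(√−1)` above `5`; the residue-field fact `IsSquare (-1 : ZMod 5)` is the companion file's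
`RcatZhou2TorsionNonsplitWitness.neg_one_isSquare_zmod_five` — its reduction is multiplicative but NOT split.
Classical arithmetic; no claim about [IUTchI–IV], the variant, or any author. [folklore] -/
theorem semistable_two_torsion_nonsplit_witness :
    (⟨0, 157, 0, -480, 0⟩ : WeierstrassCurve ℚ).IsSemistable ℤ ∧
      IsSquare (-1 : ZMod 5) ∧
      (∀ v : HeightOneSpectrum ℤ, (5 : ℤ) ∈ v.asIdeal →
        (⟨0, 157, 0, -480, 0⟩ : WeierstrassCurve ℚ).HasMultiplicativeReductionAt v ∧
          ¬ (⟨0, 157, 0, -480, 0⟩ : WeierstrassCurve ℚ).HasSplitMultiplicativeReductionAt v) :=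
  ⟨E_isSemistable, RcatZhou2TorsionNonsplitWitness.neg_one_isSquare_zmod_five,
    fun _ h5 => ⟨hasMultiplicativeReductionAt_five h5, not_hasSplitMultiplicativeReductionAt_five h5⟩⟩

end Summit.ABC.IUTFork.Repair.RcatZhou2TorsionSemistableWitness
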